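import Literature.Topology.FourManifolds.TrisectionsSectorRestructure
import Literature.Topology.FourManifolds.SeamBicollar
import Literature.Topology.FourManifolds.MorseChartChange
import Mathlib.Geometry.Manifold.Immersion
import HarnessLib

/-!
# Transporting the Morse function of a sector manifold through its embedding

Topic `Literature/Topology/FourManifolds`; infrastructure for the fact seat
`provefact-Literature.Topology.FourManifolds.exists-14560f9fc8` (named fact (c′)
`Literature.Topology.FourManifolds.exists_stabilized_gkTrisection`), continuing
`TrisectionsSectorRestructure.lean`.  Everything in this file is **proved**; no definitions,
no named facts.

Clause (ii) of `Literature.Topology.FourManifolds.IsGKTrisection` presents a sector `S i` as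
the image of a topological embedding `e : W → X` of a compact smooth `4`-manifold with boundary
carrying a handle decomposition, i.e. a Morse function `f : W → ℝ` adapted to `∂W`
(`Literature.Topology.FourManifolds.HasHandleDecomposition`).  To feed the re-structured sector
(`IsGKTrisection.exists_cornerSliceAtlas`) into
`CornerSliceAtlas.hasHandleDecomposition_of_comp_val` (`TrisectionsSectorMorse.lean`) one needs
an *ambient* function on `X` carrying the Morse data of `f` away from the central surface.  This
file provides the local transport through `e` at its immersion points (all points off the
central surface):

* `exists_charts_of_isImmersionAt` — unpacking Mathlib's chart-based `Manifold.IsImmersionAt`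
  in equal dimension `4`: charts `φ` of `W`, `ψ` of `X` and a linear automorphism `L` of `ℝ⁴`
  with `ψ ∘ e ∘ φ⁻¹ = L` on the half-space target of `φ`;
* `exists_contMDiffOn_extension_of_isImmersionAt` — a smooth `f : W → ℝ` agrees near `e w`
  with `F ∘ e` for a function `F` smooth on a neighbourhood of `e w` in `X` (Seeley's
  extension across the boundary hyperplane, the tree's `exists_contDiffOn_extension_halfSpace`);
* `not_isMCriticalPt_of_comp_eventuallyEq` — regular points of `f` go to regular points of
  `F` (chain rule);
* `morseData_of_comp_eventuallyEq` — at an *interior* immersion point: `w` is critical for `f`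
  iff `e w` is critical for `F`, and then the Hessians are congruent, so nondegeneracy and the
  Morse index agree (first- and second-order chain rules at a critical point, Milnor 1963, §2,
  with the chart-independence of the Hessian, `MorseChartChange.lean`).

## References

* J. Milnor, *Morse theory*, Ann. of Math. Studies 51 (1963), §2 (critical points, Hessian and
  index in local coordinates). [Milnor1963]
* R. T. Seeley, *Extension of `C^∞` functions defined in a half space*, Proc. Amer. Math.
  Soc. 15 (1964), 625–626. [Seeley1964]
* D. Gay, R. Kirby, *Trisecting 4-manifolds*, Geom. Topol. 20 (2016), Def. 1. [GayKirby2016]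
-/

open scoped Manifold ContDiff Topology
open Set Function Filter

noncomputable section

namespace Literature.Topology.FourManifolds

universe u

section Transport

variable {X : Type u} [TopologicalSpace X] [ChartedSpace (EuclideanSpace ℝ (Fin 4)) X]
  {W : Type u} [TopologicalSpace W] [ChartedSpace (EuclideanHalfSpace 4) W]

/-- **The charts of an immersion point of a `4`-manifold with boundary into a `4`-manifold.**
Unpacking Mathlib's `Manifold.IsImmersionAt` in equal dimension `4`: there are a chart `φ` of
the maximal atlas of `W` at `w`, a chart `ψ` of the maximal atlas of `X` containing
`e '' φ.source`, and a linear automorphism `L` of `ℝ⁴` (the linear injection `z ↦ equiv (z, 0)`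
of the definition is bijective, `ℝ⁴` being finite-dimensional) with
`ψ (e (φ⁻¹ z)) = L z` on the target of the extended chart `φ`, which is the trace
`(I⁻¹' φ.target) ∩ {z | 0 ≤ z₀}` of an open set on the half-space. [folklore] -/
theorem exists_charts_of_isImmersionAt {e : W → X} {w : W}
    (himm : Manifold.IsImmersionAt (𝓡∂ 4) (𝓡 4) ∞ e w) :
    ∃ (φ : OpenPartialHomeomorph W (EuclideanHalfSpace 4))
      (ψ : OpenPartialHomeomorph X (EuclideanSpace ℝ (Fin 4)))
      (L : EuclideanSpace ℝ (Fin 4) ≃L[ℝ] EuclideanSpace ℝ (Fin 4)),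
      φ ∈ IsManifold.maximalAtlas (𝓡∂ 4) ∞ W ∧ ψ ∈ IsManifold.maximalAtlas (𝓡 4) ∞ X ∧
      w ∈ φ.source ∧ φ.source ⊆ e ⁻¹' ψ.source ∧
      (φ.extend (𝓡∂ 4)).target = (𝓡∂ 4).symm ⁻¹' φ.target ∩ {z | 0 ≤ z 0} ∧
      (∀ z ∈ (φ.extend (𝓡∂ 4)).target, ψ (e (φ.symm ((𝓡∂ 4).symm z))) = L z) ∧
      (∀ w' ∈ φ.source, L.symm (ψ (e w')) = φ.extend (𝓡∂ 4) w' ∧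
        φ.extend (𝓡∂ 4) w' ∈ (φ.extend (𝓡∂ 4)).target) := by
  obtain ⟨Fc, _, _, h⟩ := himm
  set φ := h.domChart with hφ
  set ψ := h.codChart with hψ
  have hwφ : w ∈ φ.source := h.mem_domChart_source
  have hφmem : φ ∈ IsManifold.maximalAtlas (𝓡∂ 4) ∞ W := h.domChart_mem_maximalAtlas
  have hψmem : ψ ∈ IsManifold.maximalAtlas (𝓡 4) ∞ X := h.codChart_mem_maximalAtlas
  have hsrc : φ.source ⊆ e ⁻¹' ψ.source := h.source_subset_preimage_source
  have hwritten := h.writtenInCharts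
  rw [← hφ, ← hψ] at hwritten
  set L : EuclideanSpace ℝ (Fin 4) →L[ℝ] EuclideanSpace ℝ (Fin 4) :=
    (h.equiv : (EuclideanSpace ℝ (Fin 4) × Fc) →L[ℝ] EuclideanSpace ℝ (Fin 4)).comp
      (ContinuousLinearMap.inl ℝ (EuclideanSpace ℝ (Fin 4)) Fc) with hL
  have hLapply : ∀ z, L z = h.equiv (z, 0) := fun z => rfl
  have hLinj : Injective L := fun z z' hzz => by
    rw [hLapply, hLapply] at hzz
    exact (Prod.mk.inj (h.equiv.injective hzz)).1
  set Le : EuclideanSpace ℝ (Fin 4) ≃L[ℝ] EuclideanSpace ℝ (Fin 4) :=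
    LinearEquiv.toContinuousLinearEquiv (LinearEquiv.ofInjectiveEndo L.toLinearMap hLinj) with hLe
  have hLe : ∀ z, Le z = L z := fun z => rfl
  have hext_symm : ∀ z, (φ.extend (𝓡∂ 4)).symm z = φ.symm ((𝓡∂ 4).symm z) := fun z => by
    rw [OpenPartialHomeomorph.extend_coe_symm]; rfl
  have hkey : ∀ z ∈ (φ.extend (𝓡∂ 4)).target, ψ (e (φ.symm ((𝓡∂ 4).symm z))) = Le z := by
    intro z hz
    have := hwritten hz
    simp only [comp_apply, OpenPartialHomeomorph.extend_coe, modelWithCornersSelf_coe,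
      id_eq] at this
    rw [hext_symm] at this
    rw [this, hLe, hLapply]
  have htgt : (φ.extend (𝓡∂ 4)).target = (𝓡∂ 4).symm ⁻¹' φ.target ∩ {z | 0 ≤ z 0} := by
    rw [OpenPartialHomeomorph.extend_target, range_modelWithCornersEuclideanHalfSpace]
  refine ⟨φ, ψ, Le, hφmem, hψmem, hwφ, hsrc, htgt, hkey, fun w' hw' => ?_⟩
  have hz : φ.extend (𝓡∂ 4) w' ∈ (φ.extend (𝓡∂ 4)).target :=
    (φ.extend (𝓡∂ 4)).map_source (by rw [OpenPartialHomeomorph.extend_source]; exact hw')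
  have h1 := hkey _ hz
  have h2 : φ.symm ((𝓡∂ 4).symm (φ.extend (𝓡∂ 4) w')) = w' := by
    rw [← hext_symm]
    exact (φ.extend (𝓡∂ 4)).left_inv (by rw [OpenPartialHomeomorph.extend_source]; exact hw')
  rw [h2] at h1
  exact ⟨by rw [h1, ContinuousLinearEquiv.symm_apply_apply], hz⟩

/-- **A smooth function on an embedded `4`-manifold with boundary extends ambiently near an
immersion point** (Seeley).  If `e : W → X` is a topological embedding of a `4`-manifold with
boundary which is an immersion at `w`, and `f : W → ℝ` is smooth, then some function `F`
smooth on a neighbourhood `N` of `e w` in `X` has `F (e w') = f w'` whenever `e w' ∈ N` (in the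
charts of `exists_charts_of_isImmersionAt`, extend `f` read in `φ` across the boundary
hyperplane by Seeley's theorem, `exists_contDiffOn_extension_halfSpace`, and compose with `L⁻¹`
and `ψ`). [cite: Seeley1964, Theorem] -/
theorem exists_contMDiffOn_extension_of_isImmersionAt {e : W → X} (he : Topology.IsEmbedding e)
    {w : W} (himm : Manifold.IsImmersionAt (𝓡∂ 4) (𝓡 4) ∞ e w) {f : W → ℝ}
    (hf : ContMDiff (𝓡∂ 4) 𝓘(ℝ, ℝ) ∞ f) :
    ∃ (N : Set X) (F : X → ℝ), IsOpen N ∧ e w ∈ N ∧ ContMDiffOn (𝓡 4) 𝓘(ℝ, ℝ) ∞ F N ∧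
      ∀ w', e w' ∈ N → F (e w') = f w' := by
  obtain ⟨φ, ψ, Le, hφmem, hψmem, hwφ, hsrc, htgt, hkey, hΘe⟩ := exists_charts_of_isImmersionAt himm
  set V' : Set (EuclideanSpace ℝ (Fin 4)) := (𝓡∂ 4).symm ⁻¹' φ.target with hV'
  have hV'o : IsOpen V' := φ.open_target.preimage (𝓡∂ 4).continuous_symm
  -- `f` read in the chart `φ` is smooth on the half-space piece, and extends by Seeley
  set g : EuclideanSpace ℝ (Fin 4) → ℝ := f ∘ (φ.extend (𝓡∂ 4)).symm with hg
  have hgs : ContDiffOn ℝ ∞ g (V' ∩ {z | 0 ≤ z 0}) := by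
    rw [← htgt]
    have h1 : ContMDiffOn 𝓘(ℝ, EuclideanSpace ℝ (Fin 4)) (𝓡∂ 4) ∞ (φ.extend (𝓡∂ 4)).symm
        (φ.extend (𝓡∂ 4)).target := by
      rw [OpenPartialHomeomorph.extend_target']
      exact contMDiffOn_extend_symm hφmem
    exact contMDiffOn_iff_contDiffOn.mp (hf.comp_contMDiffOn h1)
  have hz₀ : φ.extend (𝓡∂ 4) w ∈ V' := by
    have := (hΘe w hwφ).2; rw [htgt] at this; exact this.1
  obtain ⟨V₁, hV₁o, hz₀V₁, -, G, hGs, hGg⟩ :=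
    exists_contDiffOn_extension_halfSpace hV'o hz₀ hgs
  -- the open set `N` of `X` with `e '' φ.source = range e ∩ N`
  obtain ⟨Nset, hNo, hNe⟩ := he.isInducing.isOpen_iff.1 φ.open_source
  set Θ₀ : X → EuclideanSpace ℝ (Fin 4) := fun q => Le.symm (ψ q) with hΘ₀
  have hΘ₀s : ContMDiffOn (𝓡 4) 𝓘(ℝ, EuclideanSpace ℝ (Fin 4)) ∞ Θ₀ ψ.source :=
    (contMDiff_iff_contDiff.2 Le.symm.contDiff).comp_contMDiffOn
      (contMDiffOn_of_mem_maximalAtlas hψmem)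
  set N : Set X := ψ.source ∩ Θ₀ ⁻¹' V₁ ∩ Nset with hN
  have hNo' : IsOpen N :=
    ((hΘ₀s.continuousOn.isOpen_inter_preimage ψ.open_source hV₁o)).inter hNo
  refine ⟨N, G ∘ Θ₀, hNo', ⟨⟨hsrc hwφ, ?_⟩, by rw [← hNe] at hwφ; exact hwφ⟩, ?_, fun w' hw' => ?_⟩
  · show Θ₀ (e w) ∈ V₁
    rw [hΘ₀]; dsimp only; rw [(hΘe w hwφ).1]; exact hz₀V₁
  · have h1 : ContMDiffOn 𝓘(ℝ, EuclideanSpace ℝ (Fin 4)) 𝓘(ℝ, ℝ) ∞ G V₁ :=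
      contMDiffOn_iff_contDiffOn.2 hGs
    exact h1.comp (hΘ₀s.mono fun q hq => hq.1.1) fun q hq => hq.1.2
  · obtain ⟨⟨-, hwV₁⟩, hwN⟩ := hw'
    have hw'φ : w' ∈ φ.source := by rw [← hNe]; exact hwN
    obtain ⟨h1, h2⟩ := hΘe w' hw'φ
    show G (Le.symm (ψ (e w'))) = f w'
    rw [h1]
    have hmem : φ.extend (𝓡∂ 4) w' ∈ V₁ ∩ {z | 0 ≤ z 0} := by
      refine ⟨?_, by rw [htgt] at h2; exact h2.2⟩
      have : Θ₀ (e w') ∈ V₁ := hwV₁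
      rw [hΘ₀] at this; dsimp only at this; rwa [h1] at this
    rw [hGg hmem, hg, comp_apply]
    congr 1
    exact (φ.extend (𝓡∂ 4)).left_inv (by rw [OpenPartialHomeomorph.extend_source]; exact hw'φ)

/-- **Regularity passes to the ambient extension.**  If `F ∘ e` agrees with `f` near `w`, `F` is
differentiable at `e w` and `e` at `w`, then a regular point `w` of `f` is mapped to a regular
point of `F` (chain rule `df_w = dF_{e w} ∘ de_w`). [cite: Milnor1963, §2] -/
theorem not_isMCriticalPt_of_comp_eventuallyEq [IsManifold (𝓡 4) ∞ X] [IsManifold (𝓡∂ 4) ∞ W]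
    {e : W → X} {w : W}
    (he : MDifferentiableAt (𝓡∂ 4) (𝓡 4) e w) {f : W → ℝ} {F : X → ℝ}
    (hF : MDifferentiableAt (𝓡 4) 𝓘(ℝ, ℝ) F (e w)) (heq : ∀ᶠ w' in 𝓝 w, F (e w') = f w')
    (hreg : ¬ IsMCriticalPt (𝓡∂ 4) f w) : ¬ IsMCriticalPt (𝓡 4) F (e w) := by
  intro hc
  apply hreg
  have h1 : mfderiv (𝓡∂ 4) 𝓘(ℝ, ℝ) (F ∘ e) w =
      (mfderiv (𝓡 4) 𝓘(ℝ, ℝ) F (e w)).comp (mfderiv (𝓡∂ 4) (𝓡 4) e w) := mfderiv_comp w hF he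
  have h2 : mfderiv (𝓡∂ 4) 𝓘(ℝ, ℝ) f w = mfderiv (𝓡∂ 4) 𝓘(ℝ, ℝ) (F ∘ e) w :=
    Filter.EventuallyEq.mfderiv_eq (heq.mono fun w' hw' => hw'.symm)
  unfold IsMCriticalPt at hc ⊢
  rw [h2, h1, hc]
  exact ContinuousLinearMap.zero_comp _


/-- **Morse data are transported through the embedding at interior immersion points.**  Let
`e : W → X` be an immersion at the interior point `w` of the `4`-manifold with boundary `W`,
`f : W → ℝ` smooth at `w`, and `F : X → ℝ` smooth at `e w` with `F ∘ e = f` near `w`.  Then `w`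
is a critical point of `f` iff `e w` is a critical point of `F`, and in that case the Hessians
are congruent: nondegeneracy and the Morse index agree.  (Read everything in the charts of
`exists_charts_of_isImmersionAt`: `f` written in the preferred chart of `W` at `w` is
`(F ∘ ψ⁻¹) ∘ L ∘ τ` with `τ` the change of coordinates of `W`, whose derivative at the interior
point is invertible; first- and second-order chain rules at a critical point, Milnor 1963, §2,
and chart-independence of the Hessian of `F`, `mhessian_apply_eq_hessianInChart`.)
[cite: Milnor1963, §2] -/
theorem morseData_of_comp_eventuallyEq [IsManifold (𝓡 4) ∞ X] [IsManifold (𝓡∂ 4) ∞ W]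
    {e : W → X} {w : W} (himm : Manifold.IsImmersionAt (𝓡∂ 4) (𝓡 4) ∞ e w)
    (hint : (𝓡∂ 4).IsInteriorPoint w) {f : W → ℝ} (hf : ContMDiffAt (𝓡∂ 4) 𝓘(ℝ, ℝ) ∞ f w)
    {F : X → ℝ} (hF : ContMDiffAt (𝓡 4) 𝓘(ℝ, ℝ) ∞ F (e w))
    (heq : ∀ᶠ w' in 𝓝 w, F (e w') = f w') :
    (IsMCriticalPt (𝓡∂ 4) f w ↔ IsMCriticalPt (𝓡 4) F (e w)) ∧
    (IsMCriticalPt (𝓡 4) F (e w) →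
      ((mhessian (𝓡∂ 4) f w).Nondegenerate ↔ (mhessian (𝓡 4) F (e w)).Nondegenerate) ∧
      morseIndex (𝓡∂ 4) f w = morseIndex (𝓡 4) F (e w)) := by
  obtain ⟨φ, ψ, Le, hφmem, hψmem, hwφ, hsrc, htgt, hkey, hΘe⟩ := exists_charts_of_isImmersionAt himm
  have hew : e w ∈ ψ.source := hsrc hwφ
  have hψmem2 : ψ ∈ IsManifold.maximalAtlas (𝓡 4) 2 X :=
    IsManifold.maximalAtlas_subset_of_le (M := X) (I := 𝓡 4) ENat.LEInfty.out hψmem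
  have hF2 : ContMDiffAt (𝓡 4) 𝓘(ℝ, ℝ) 2 F (e w) := hF.of_le ENat.LEInfty.out
  have hcont_e : ContinuousAt e w := himm.contMDiffAt.continuousAt
  -- the preferred extended chart of `W` at the interior point `w`
  set χ := extChartAt (𝓡∂ 4) w with hχ
  set z₀ : EuclideanSpace ℝ (Fin 4) := χ w with hz₀
  have hzint : z₀ ∈ interior (range (𝓡∂ 4)) := hint
  have hrange : range (𝓡∂ 4) ∈ 𝓝 z₀ := mem_interior_iff_mem_nhds.1 hzint
  have hχsymm0 : χ.symm z₀ = w := extChartAt_to_inv w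
  have hχtgt : χ.target ∈ 𝓝 z₀ := by
    have h := extChartAt_target_mem_nhdsWithin (I := 𝓡∂ 4) w
    rwa [nhdsWithin_eq_nhds.2 hrange] at h
  have hχc : ContinuousAt χ.symm z₀ :=
    ((continuousOn_extChartAt_symm w).continuousWithinAt (mem_of_mem_nhds hχtgt)).continuousAt
      hχtgt
  -- the change of coordinates `τ` of `W` from the preferred chart to `φ`
  set τ := (𝓡∂ 4).extendCoordChange (chartAt (EuclideanHalfSpace 4) w) φ with hτ
  have hτapply : ∀ z, τ z = φ.extend (𝓡∂ 4) (χ.symm z) := fun z => rfl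
  have hτsrc : τ.source ∈ 𝓝 z₀ := by
    have h : τ.source ∈ 𝓝[range (𝓡∂ 4)] z₀ :=
      (𝓡∂ 4).extendCoordChange_source_mem_nhdsWithin'
        (e := chartAt (EuclideanHalfSpace 4) w) (e' := φ) (mem_chart_source _ w) hwφ
    rwa [nhdsWithin_eq_nhds.2 hrange] at h
  have hz₀src : z₀ ∈ τ.source := mem_of_mem_nhds hτsrc
  have hτs : ContDiffAt ℝ ∞ τ z₀ :=
    ((𝓡∂ 4).contDiffWithinAt_extendCoordChange' (IsManifold.chart_mem_maximalAtlas w) hφmem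
      (mem_chart_source _ w) hwφ).contDiffAt hrange
  have hτinv : (fderiv ℝ τ z₀).IsInvertible := by
    have h := (𝓡∂ 4).isInvertible_fderivWithin_extendCoordChange (n := ∞) (by simp)
      (IsManifold.chart_mem_maximalAtlas w) hφmem hz₀src
    rwa [fderivWithin_of_mem_nhds hτsrc] at h
  -- `f` written in the preferred chart factors as `g ∘ T`, `T = ψ ∘ e ∘ χ⁻¹ = Le ∘ τ`
  set g : EuclideanSpace ℝ (Fin 4) → ℝ := F ∘ (ψ.extend (𝓡 4)).symm with hg
  set T : EuclideanSpace ℝ (Fin 4) → EuclideanSpace ℝ (Fin 4) := fun z => ψ (e (χ.symm z))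
    with hT
  have hTz₀ : T z₀ = ψ (e w) := by simp only [hT, hχsymm0]
  have hText : T z₀ = ψ.extend (𝓡 4) (e w) := by rw [hTz₀]; simp
  have hTeq : T =ᶠ[𝓝 z₀] fun z => Le (τ z) := by
    filter_upwards [hτsrc] with z hz
    have hz2 : χ.symm z ∈ φ.source := by
      have := hz.2
      simp only [mem_preimage, OpenPartialHomeomorph.extend_source] at this
      exact this
    obtain ⟨h1, -⟩ := hΘe _ hz2
    show ψ (e (χ.symm z)) = Le (τ z)
    rw [hτapply, ← h1, ContinuousLinearEquiv.apply_symm_apply]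
  have hTs : ContDiffAt ℝ ∞ T z₀ :=
    (((Le : EuclideanSpace ℝ (Fin 4) →L[ℝ] EuclideanSpace ℝ (Fin 4)).contDiff.contDiffAt).comp
      z₀ hτs).congr_of_eventuallyEq hTeq
  have hTd : fderiv ℝ T z₀ = (Le : EuclideanSpace ℝ (Fin 4) →L[ℝ] EuclideanSpace ℝ (Fin 4)).comp
      (fderiv ℝ τ z₀) := by
    rw [hTeq.fderiv_eq]
    exact ((Le : EuclideanSpace ℝ (Fin 4) →L[ℝ] EuclideanSpace ℝ (Fin 4)).hasFDerivAt.comp z₀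
      ((hτs.differentiableAt (by simp)).hasFDerivAt)).fderiv
  obtain ⟨Lτ, hLτ⟩ := hτinv
  set DT : EuclideanSpace ℝ (Fin 4) ≃L[ℝ] EuclideanSpace ℝ (Fin 4) := Lτ.trans Le with hDT
  have hDTcoe : (DT : EuclideanSpace ℝ (Fin 4) →L[ℝ] EuclideanSpace ℝ (Fin 4)) = fderiv ℝ T z₀ := by
    rw [hTd, ← hLτ]; rfl
  -- `g` is smooth at `T z₀`
  have hgs : ContDiffAt ℝ ∞ g (T z₀) := by
    have h1 : ContMDiffAt 𝓘(ℝ, EuclideanSpace ℝ (Fin 4)) (𝓡 4) ∞ ψ.symm (ψ (e w)) :=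
      (contMDiffOn_symm_of_mem_maximalAtlas hψmem).contMDiffAt
        (ψ.open_target.mem_nhds (ψ.map_source hew))
    have h2 : ContMDiffAt 𝓘(ℝ, EuclideanSpace ℝ (Fin 4)) 𝓘(ℝ, ℝ) ∞ (F ∘ ψ.symm) (ψ (e w)) := by
      refine ContMDiffAt.comp (ψ (e w)) ?_ h1
      rw [ψ.left_inv hew]; exact hF
    have h3 : g = F ∘ ψ.symm := by ext z; simp [hg]
    rw [h3, hTz₀]
    exact contMDiffAt_iff_contDiffAt.mp h2
  -- the written function agrees with `g ∘ T` near `z₀`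
  have hwritten : writtenInExtChartAt (𝓡∂ 4) 𝓘(ℝ, ℝ) w f =ᶠ[𝓝 z₀] g ∘ T := by
    have hev : ∀ᶠ z in 𝓝 z₀, F (e (χ.symm z)) = f (χ.symm z) ∧ e (χ.symm z) ∈ ψ.source := by
      have h1 : ∀ᶠ w' in 𝓝 w, F (e w') = f w' ∧ e w' ∈ ψ.source :=
        heq.and (hcont_e.preimage_mem_nhds (ψ.open_source.mem_nhds hew))
      rw [← hχsymm0] at h1
      exact hχc.eventually h1
    filter_upwards [hev] with z hz
    rw [writtenInExtChartAt_eq_comp_extend_symm]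
    show f (χ.symm z) = g (T z)
    simp only [hg, hT, comp_apply]
    rw [← hz.1]
    congr 1
    have : (ψ.extend (𝓡 4)).symm (ψ (e (χ.symm z))) = ψ.symm (ψ (e (χ.symm z))) := by simp
    rw [this, ψ.left_inv hz.2]
  -- ### critical points
  have hcritW : IsMCriticalPt (𝓡∂ 4) f w ↔ fderiv ℝ (g ∘ T) z₀ = 0 := by
    rw [isMCriticalPt_iff_fderivWithin_writtenInExtChartAt_eq_zero (I := 𝓡∂ 4) (x₀ := w)
      (mem_extChartAt_source w) (hf.mdifferentiableAt (by simp)), ← hz₀,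
      fderivWithin_of_mem_nhds hrange, hwritten.fderiv_eq]
  have hchain : fderiv ℝ (g ∘ T) z₀ = (fderiv ℝ g (T z₀)).comp (fderiv ℝ T z₀) :=
    fderiv_comp z₀ (hgs.differentiableAt (by simp)) (hTs.differentiableAt (by simp))
  have hcritX : IsMCriticalPt (𝓡 4) F (e w) ↔ fderiv ℝ g (T z₀) = 0 := by
    rw [isMCriticalPt_iff_fderiv_comp_extend_symm_eq_zero hF2 hψmem2 hew, hText]
  have hiff : IsMCriticalPt (𝓡∂ 4) f w ↔ IsMCriticalPt (𝓡 4) F (e w) := by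
    rw [hcritW, hcritX, hchain, ← hDTcoe]
    constructor
    · intro h
      have h2 : ((fderiv ℝ g (T z₀)).comp (DT : EuclideanSpace ℝ (Fin 4) →L[ℝ] _)).comp
          (DT.symm : EuclideanSpace ℝ (Fin 4) →L[ℝ] _) = 0 := by
        rw [h, ContinuousLinearMap.zero_comp]
      rwa [ContinuousLinearMap.comp_assoc, ContinuousLinearEquiv.coe_comp_coe_symm,
        ContinuousLinearMap.comp_id] at h2
    · intro h
      rw [h, ContinuousLinearMap.zero_comp]
  refine ⟨hiff, fun hc => ?_⟩
  -- ### Hessians at a critical point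
  have hcrit_g : fderiv ℝ g (T z₀) = 0 := hcritX.1 hc
  -- the Hessian of `f` at `w` is the plain second derivative of `g ∘ T` at `z₀`
  have hopen : IsOpen (interior (range (𝓡∂ 4))) := isOpen_interior
  have hHessW : ∀ v v' : EuclideanSpace ℝ (Fin 4), mhessian (𝓡∂ 4) f w v v' =
      fderiv ℝ (fderiv ℝ (g ∘ T)) z₀ v v' := by
    intro v v'
    have h1 : fderivWithin ℝ (writtenInExtChartAt (𝓡∂ 4) 𝓘(ℝ, ℝ) w f) (range (𝓡∂ 4)) =ᶠ[𝓝 z₀]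
        fderiv ℝ (g ∘ T) := by
      filter_upwards [hopen.mem_nhds hzint, hwritten.eventuallyEq_nhds] with z hz hz'
      rw [fderivWithin_of_mem_nhds (mem_interior_iff_mem_nhds.1 hz), hz'.fderiv_eq]
    rw [mhessian]
    simp only [LinearMap.coe_comp, comp_apply, ContinuousLinearMap.coe_coe,
      ContinuousLinearMap.coeLM_apply]
    rw [← hz₀, h1.fderivWithin_eq_of_nhds, fderivWithin_of_mem_nhds hrange]
  -- second-order chain rule at the critical point
  have hchain2 : ∀ v v' : EuclideanSpace ℝ (Fin 4), fderiv ℝ (fderiv ℝ (g ∘ T)) z₀ v v' =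
      fderiv ℝ (fderiv ℝ g) (T z₀) (DT v) (DT v') := by
    intro v v'
    rw [fderiv_fderiv_comp_apply_of_fderiv_eq_zero (hgs.of_le (by norm_cast))
      (hTs.of_le (by norm_cast)) hcrit_g v v', ← hDTcoe]
    rfl
  -- the chart Hessian of `F` in `ψ` is the plain second derivative of `g`
  have hHessChart : ∀ a b : EuclideanSpace ℝ (Fin 4), hessianInChart (𝓡 4) ψ F (e w) a b =
      fderiv ℝ (fderiv ℝ g) (T z₀) a b := by
    intro a b
    rw [hessianInChart_apply_apply, ModelWithCorners.Boundaryless.range_eq_univ,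
      fderivWithin_univ, fderivWithin_univ, ← hText]
  -- the Hessian of `F` at `e w` is congruent to the chart Hessian
  obtain ⟨L₁, hL₁⟩ := isInvertible_fderiv_extendCoordChange_chartAt (I := 𝓡 4) hψmem2 hew
  have hHessX : ∀ a b : EuclideanSpace ℝ (Fin 4), mhessian (𝓡 4) F (e w) a b =
      hessianInChart (𝓡 4) ψ F (e w) (L₁ a) (L₁ b) := by
    intro a b
    rw [mhessian_apply_eq_hessianInChart hF2 hc hψmem2 hew, ← hL₁]
    rfl
  -- assemble: `mhessian f w (v, v') = mhessian F (e w) (M v, M v')`, `M = L₁⁻¹ ∘ DT`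
  set M : EuclideanSpace ℝ (Fin 4) ≃L[ℝ] EuclideanSpace ℝ (Fin 4) := DT.trans L₁.symm with hM
  have hcongr : ∀ v v' : EuclideanSpace ℝ (Fin 4),
      mhessian (𝓡∂ 4) f w v v' = mhessian (𝓡 4) F (e w) (M v) (M v') := by
    intro v v'
    rw [hHessW, hchain2, hHessX, ← hHessChart]
    simp only [hM, ContinuousLinearEquiv.trans_apply, ContinuousLinearEquiv.apply_symm_apply]
  refine ⟨nondegenerate_iff_of_forall_apply_eq M.toLinearEquiv fun v v' => hcongr v v', ?_⟩
  unfold morseIndex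
  exact sigNeg_eq_of_forall_apply_eq M.toLinearEquiv fun v v' => hcongr v v'

end Transport

end Literature.Topology.FourManifolds
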